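import Mathlib
import Literature.AlgebraicGeometry.Resolution.CobordantBlowupFiltration
import Summits.ResolutionOfSingularities.ResolutionOfSingularities.Theorems.WeightedInvariantDatumToEmbeddedExceptionalCharts
import HarnessLib

/-!
# The bigrading of the extended Rees algebra of a filtration by homogeneous ideals

Topic: `Summits/ResolutionOfSingularities/ResolutionOfSingularities/Theorems`. Helper file of the
stub `stub_qs_atlas_ambient` of the line `Sketch` of the crux `Theses.WeightedInvariant.DatumToEmbedded`
(statement `stmt-ResolutionOfSingularities-0572`) of the summit
`Summit.ResolutionOfSingularities.ResolutionOfSingularities`.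

For a commutative ring `A = ⨁ᵢ Aᵢ` graded by an additive commutative monoid `ι` (a torus action
on `Spec A`) the Laurent polynomial ring `A[t, t⁻¹]` is graded by `ι × ℤ`,
`A[t, t⁻¹]_{(i, n)} = Aᵢ tⁿ` (`laurentPiece`, `nonempty_gradedRing_laurentPiece`; the product
action of the torus and of `𝔾ₘ`), with homogeneous components
`p ↦ (p_n)ᵢ tⁿ` (`coe_decompose_laurentPiece`). If the pieces `Jₙ` of a filtration `F` of `A`
are homogeneous ideals, the extended Rees algebra `⊕ₙ Jₙ tⁿ ⊆ A[t, t⁻¹]`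
(`IdealFiltration.extendedRees`, `Literature/…/CobordantBlowupFiltration.lean`; Włodarczyk,
arXiv:2203.03090, Def. 5.1.1) contains the homogeneous components of its elements
(`decompose_mem_extendedRees`), hence is a graded subring — the `𝔾ₘʲ⁺¹`-action on the full
cobordant blow-up `B = Spec ⊕ₙ Jₙ tⁿ` of a `𝔾ₘʲ`-stable centre (ibid. §2.3.3). The last section
records the elementary identities in a localisation `(⊕ₙ Jₙ tⁿ)[1/β t^D]` (`β ∈ J_D`) used by the
chart `D(β t^D)` of `B₊`: `β t^D · (t⁻¹)^D = β`, `t⁻¹` is a non-zero-divisor, and the degree-`0`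
elements `x t^{Dl} / (β t^D)^l`.

Only Mathlib, `CobordantBlowupFiltration.lean` and `Exceptional.coe_t_pow` are used.
-/

-- the summit namespace repeats `ResolutionOfSingularities` by design (mandated namespace)
set_option linter.dupNamespace false

noncomputable section

namespace Summit.ResolutionOfSingularities.ResolutionOfSingularities.Theorems.DatumToEmbedded.AtlasAmbient

open scoped LaurentPolynomial
open LaurentPolynomial DirectSum Literature.AlgebraicGeometry.Resolution

/-! ## The bigrading `A[t, t⁻¹]_{(i,n)} = Aᵢ tⁿ` -/

section Laurent

variable {ι A : Type*} [AddCommMonoid ι] [DecidableEq ι] [CommRing A] (𝒜₀ : ι → Submodule ℤ A)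
  [GradedRing 𝒜₀]

/-- **The pieces `Aᵢ tⁿ` of the Laurent polynomial ring over a graded ring.** [folklore] -/
def laurentPiece (k : ι × ℤ) : Submodule ℤ A[T;T⁻¹] where
  carrier := {p | ∃ a ∈ 𝒜₀ k.1, p = C a * T k.2}
  zero_mem' := ⟨0, zero_mem _, by rw [map_zero, zero_mul]⟩
  add_mem' := by
    rintro _ _ ⟨a, ha, rfl⟩ ⟨b, hb, rfl⟩
    exact ⟨a + b, add_mem ha hb, by rw [map_add, add_mul]⟩
  smul_mem' := by
    rintro c _ ⟨a, ha, rfl⟩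
    exact ⟨c • a, Submodule.smul_mem _ c ha, by
      rw [zsmul_eq_mul, zsmul_eq_mul, map_mul, map_intCast, mul_assoc]⟩

variable {𝒜₀} in
omit [AddCommMonoid ι] [DecidableEq ι] [GradedRing 𝒜₀] in
/-- Membership in `Aᵢ tⁿ`. [folklore] -/
theorem mem_laurentPiece_iff {k : ι × ℤ} {p : A[T;T⁻¹]} :
    p ∈ laurentPiece 𝒜₀ k ↔ ∃ a ∈ 𝒜₀ k.1, p = C a * T k.2 :=
  Iff.rfl

variable {𝒜₀} in
omit [AddCommMonoid ι] [DecidableEq ι] [GradedRing 𝒜₀] in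
/-- `a tⁿ ∈ Aᵢ tⁿ` for `a ∈ Aᵢ`. [folklore] -/
theorem C_mul_T_mem_laurentPiece {i : ι} {a : A} (ha : a ∈ 𝒜₀ i) (n : ℤ) :
    C a * T n ∈ laurentPiece 𝒜₀ (i, n) :=
  ⟨a, ha, rfl⟩

/-- The pieces `Aᵢ tⁿ` form a graded monoid. [folklore] -/
theorem gradedMonoid_laurentPiece : SetLike.GradedMonoid (laurentPiece 𝒜₀) where
  one_mem := ⟨1, SetLike.one_mem_graded 𝒜₀, by rw [map_one, one_mul]; exact T_zero.symm⟩
  mul_mem := by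
    rintro k k' _ _ ⟨a, ha, rfl⟩ ⟨b, hb, rfl⟩
    exact ⟨a * b, SetLike.mul_mem_graded ha hb, by
      rw [map_mul, Prod.snd_add, T_add]; ring⟩

/-- The projection `p ↦ (p_n)ᵢ` onto the coefficient of `Aᵢ tⁿ`. [folklore] -/
def proj (k : ι × ℤ) : A[T;T⁻¹] →+ A :=
  AddMonoidHom.mk' (fun p => (decompose 𝒜₀ (p.coeff k.2) k.1 : A)) fun p q => by
    rw [AddMonoidAlgebra.coeff_add, Finsupp.add_apply, decompose_add, DirectSum.add_apply,
      Submodule.coe_add]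

/-- Unfolding the projection. [folklore] -/
theorem proj_apply (k : ι × ℤ) (p : A[T;T⁻¹]) :
    proj 𝒜₀ k p = (decompose 𝒜₀ (p.coeff k.2) k.1 : A) :=
  rfl

/-- The projection of a homogeneous element `a tⁿ`. [folklore] -/
theorem proj_C_mul_T (k k' : ι × ℤ) {a : A} (ha : a ∈ 𝒜₀ k'.1) :
    proj 𝒜₀ k (C a * T k'.2) = if k' = k then a else 0 := by
  rw [proj_apply, ← single_eq_C_mul_T, AddMonoidAlgebra.coeff_single, Finsupp.single_apply]
  by_cases h2 : k'.2 = k.2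
  · rw [if_pos h2]
    by_cases h1 : k'.1 = k.1
    · rw [← h1, decompose_of_mem_same 𝒜₀ ha, if_pos (Prod.ext h1 h2)]
    · rw [decompose_of_mem_ne 𝒜₀ ha h1, if_neg fun h => h1 (congrArg Prod.fst h)]
  · rw [if_neg h2, decompose_zero, zero_apply, ZeroMemClass.coe_zero,
      if_neg fun h => h2 (congrArg Prod.snd h)]

/-- A homogeneous element is `(its projection) tⁿ`. [folklore] -/
theorem eq_C_proj_mul_T {k : ι × ℤ} {q : A[T;T⁻¹]} (hq : q ∈ laurentPiece 𝒜₀ k) :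
    q = C (proj 𝒜₀ k q) * T k.2 := by
  obtain ⟨a, ha, rfl⟩ := hq
  rw [proj_C_mul_T 𝒜₀ k k ha, if_pos rfl]

/-- The projections onto other pieces kill a homogeneous element. [folklore] -/
theorem proj_eq_zero_of_mem {k k' : ι × ℤ} {q : A[T;T⁻¹]} (hq : q ∈ laurentPiece 𝒜₀ k')
    (hk : k' ≠ k) : proj 𝒜₀ k q = 0 := by
  obtain ⟨a, ha, rfl⟩ := hq
  rw [proj_C_mul_T 𝒜₀ k k' ha, if_neg hk]

/-- The pieces `Aᵢ tⁿ` are independent (apply the projections). [folklore] -/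
theorem iSupIndep_laurentPiece : iSupIndep (laurentPiece 𝒜₀) := by
  rw [iSupIndep_iff_finsetSum_eq_zero_imp_eq_zero]
  intro s v hv hsum k hk
  have h := congrArg (proj 𝒜₀ k) hsum
  rw [map_sum, map_zero, Finset.sum_eq_single k (fun k' hk' hne => proj_eq_zero_of_mem 𝒜₀
    (hv k' hk') hne) (fun h => absurd hk h)] at h
  rw [eq_C_proj_mul_T 𝒜₀ (hv k hk), h, map_zero, zero_mul]

/-- The pieces `Aᵢ tⁿ` span: `p = ∑ₙ ∑ᵢ (pₙ)ᵢ tⁿ`. [folklore] -/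
theorem iSup_laurentPiece_eq_top : ⨆ k, laurentPiece 𝒜₀ k = ⊤ := by
  classical
  rw [eq_top_iff]
  rintro p -
  rw [← AddMonoidAlgebra.sum_coeff_single p, Finsupp.sum]
  refine Submodule.sum_mem _ fun n _ => ?_
  rw [single_eq_C_mul_T, ← sum_support_decompose 𝒜₀ (p.coeff n), map_sum, Finset.sum_mul]
  exact Submodule.sum_mem _ fun i _ => Submodule.mem_iSup_of_mem (i, n)
    (C_mul_T_mem_laurentPiece (SetLike.coe_mem _) n)

/-- **`A[t, t⁻¹]` is graded by `ι × ℤ` with pieces `Aᵢ tⁿ`.** [folklore] -/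
theorem nonempty_gradedRing_laurentPiece : Nonempty (GradedRing (laurentPiece 𝒜₀)) :=
  have hint : DirectSum.IsInternal (laurentPiece 𝒜₀) :=
    (DirectSum.isInternal_submodule_iff_iSupIndep_and_iSup_eq_top _).2
      ⟨iSupIndep_laurentPiece 𝒜₀, iSup_laurentPiece_eq_top 𝒜₀⟩
  ⟨{ (gradedMonoid_laurentPiece 𝒜₀) with toDecomposition := hint.chooseDecomposition }⟩

/-- **The homogeneous components in `A[t, t⁻¹]`**: the `(i, n)`-component of `p` is `(pₙ)ᵢ tⁿ`
(for any graded-ring structure with these pieces). [folklore] -/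
theorem coe_decompose_laurentPiece [GradedRing (laurentPiece 𝒜₀)] (p : A[T;T⁻¹]) (k : ι × ℤ) :
    (decompose (laurentPiece 𝒜₀) p k : A[T;T⁻¹]) =
      C (decompose 𝒜₀ (p.coeff k.2) k.1 : A) * T k.2 := by
  classical
  have hproj : proj 𝒜₀ k p = proj 𝒜₀ k (decompose (laurentPiece 𝒜₀) p k : A[T;T⁻¹]) := by
    conv_lhs => rw [← sum_support_decompose (laurentPiece 𝒜₀) p]
    rw [map_sum, Finset.sum_eq_single k (fun k' _ hne => proj_eq_zero_of_mem 𝒜₀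
      (SetLike.coe_mem _) hne)]
    intro hk
    rw [DFinsupp.notMem_support_iff.mp hk, ZeroMemClass.coe_zero, map_zero]
  rw [← proj_apply, hproj]
  exact eq_C_proj_mul_T 𝒜₀ (SetLike.coe_mem _)

end Laurent

/-! ## The extended Rees algebra of a filtration by homogeneous ideals -/

section Rees

variable {ι A : Type*} [AddCommMonoid ι] [DecidableEq ι] [CommRing A] (𝒜₀ : ι → Submodule ℤ A)
  [GradedRing 𝒜₀] (F : IdealFiltration A)

/-- **`⊕ₙ Jₙ tⁿ` contains the homogeneous components of its elements** when every `Jₙ` is a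
homogeneous ideal: the `(i, n)`-component of `x` is `(xₙ)ᵢ tⁿ` and `(xₙ)ᵢ ∈ Jₙ`. Hence the
extended Rees algebra is a graded subring of `A[t, t⁻¹]` (Włodarczyk 2022, §2.3.3: the torus of
`Y` times `𝔾ₘ` acts on the cobordant blow-up of a torus-stable centre).
[cite: Wlodarczyk2022, §2.3.3] -/
theorem decompose_mem_extendedRees [GradedRing (laurentPiece 𝒜₀)]
    (hF : ∀ n, (F.ideal n).IsHomogeneous 𝒜₀) {x : A[T;T⁻¹]} (hx : x ∈ F.extendedRees)
    (k : ι × ℤ) : (decompose (laurentPiece 𝒜₀) x k : A[T;T⁻¹]) ∈ F.extendedRees := by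
  rw [coe_decompose_laurentPiece, ← single_eq_C_mul_T, IdealFiltration.single_mem_extendedRees_iff]
  intro n hn
  exact hF n k.1 (hx k.2 n hn)

variable {𝒜₀ F}

omit [AddCommMonoid ι] [DecidableEq ι] [GradedRing 𝒜₀] in
/-- The structure map is homogeneous of `t`-degree `0`: `a ↦ a t⁰ ∈ Aᵢ t⁰` for `a ∈ Aᵢ`.
[folklore] -/
theorem coe_algebraMap_mem_laurentPiece {i : ι} {a : A} (ha : a ∈ 𝒜₀ i) :
    ((algebraMap A F.extendedRees a : F.extendedRees) : A[T;T⁻¹]) ∈ laurentPiece 𝒜₀ (i, 0) := by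
  rw [Subalgebra.coe_algebraMap, ← C_eq_algebraMap, ← mul_one (C a), ← T_zero]
  exact C_mul_T_mem_laurentPiece ha 0

omit [DecidableEq ι] in
/-- `t⁻¹` is homogeneous of degree `(0, -1)`. [folklore] -/
theorem T_neg_one_mem_laurentPiece [SetLike.GradedMonoid 𝒜₀] :
    (T (-1) : A[T;T⁻¹]) ∈ laurentPiece 𝒜₀ (0, -1) := by
  rw [← one_mul (T (-1)), ← map_one C]
  exact C_mul_T_mem_laurentPiece (SetLike.one_mem_graded 𝒜₀) (-1)

omit [AddCommMonoid ι] [DecidableEq ι] [GradedRing 𝒜₀] in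
/-- **The elements of `⊕ₙ Jₙ tⁿ` of degree `(i, m)`, `m ≥ 0`, are the `a tᵐ` with
`a ∈ Jₘ ∩ Aᵢ`.** [folklore] -/
theorem exists_of_coe_mem_laurentPiece {i : ι} {m : ℕ} {x : F.extendedRees}
    (hx : (x : A[T;T⁻¹]) ∈ laurentPiece 𝒜₀ (i, (m : ℤ))) :
    ∃ a : A, a ∈ 𝒜₀ i ∧ a ∈ F.ideal m ∧ (x : A[T;T⁻¹]) = C a * T (m : ℤ) := by
  obtain ⟨a, ha, hxa⟩ := hx
  refine ⟨a, ha, F.C_mul_T_mem_extendedRees_iff.mp ?_, hxa⟩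
  rw [← hxa]
  exact x.2

end Rees

/-! ## Identities in the localisation `(⊕ₙ Jₙ tⁿ)[1/β t^D]` -/

section Local

variable {ι A : Type*} [CommRing A] (𝒜₀ : ι → Submodule ℤ A) (F : IdealFiltration A)
  (t : F.extendedRees) (ht : (t : A[T;T⁻¹]) = T (-1))

include ht in
/-- **`a tᵐ · (t⁻¹)ᵐ = a`** in `⊕ₙ Jₙ tⁿ` (`a ∈ Jₘ`). [folklore] -/
theorem mul_t_pow_eq_algebraMap {m : ℕ} {a : A} (x : F.extendedRees)
    (hx : (x : A[T;T⁻¹]) = C a * T (m : ℤ)) : x * t ^ m = algebraMap A F.extendedRees a := by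
  apply Subtype.ext
  rw [MulMemClass.coe_mul, Exceptional.coe_t_pow F t ht, hx, mul_T_assoc, add_neg_cancel, T_zero, mul_one,
    Subalgebra.coe_algebraMap, C_eq_algebraMap]

include ht in
/-- **`t⁻¹` is a non-zero-divisor of `⊕ₙ Jₙ tⁿ`** (it is a unit of `A[t, t⁻¹]`). [folklore] -/
theorem t_mem_nonZeroDivisors : t ∈ nonZeroDivisors F.extendedRees :=
  mem_nonZeroDivisors_of_injective (f := F.extendedRees.val) Subtype.val_injective
    (by rw [Subalgebra.coe_val, ht]; exact (isUnit_T (-1)).mem_nonZeroDivisors)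

variable (L : Type*) [CommRing L] [Algebra F.extendedRees L] (g : F.extendedRees)

include ht in
/-- In any localisation `(⊕ₙ Jₙ tⁿ)[1/g]`, `t⁻¹` stays a non-zero-divisor. [folklore] -/
theorem algebraMap_t_mem_nonZeroDivisors [IsLocalization.Away g L] :
    algebraMap F.extendedRees L t ∈ nonZeroDivisors L :=
  IsLocalization.nonZeroDivisors_le_comap (Submonoid.powers g) L (t_mem_nonZeroDivisors F t ht)

variable (h : F.extendedRees) {Dg : ℕ} {β : A} (hh : (h : A[T;T⁻¹]) = C β * T (Dg : ℤ))

include ht hh in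
/-- **The chart `D(β t^D)` is where `β = (t⁻¹)^D · unit`**: if `u (t⁻¹)^D = β` in a
localisation `(⊕ₙ Jₙ tⁿ)[1/g]`, then `u = h := β t^D` there; in particular `u` is a unit iff `h`
is. [folklore] -/
theorem eq_algebraMap_of_mul_t_pow_eq [IsLocalization.Away g L] {u : L}
    (hu : u * algebraMap F.extendedRees L t ^ Dg =
      algebraMap F.extendedRees L (algebraMap A F.extendedRees β)) :
    u = algebraMap F.extendedRees L h := by
  rw [← mul_t_pow_eq_algebraMap F t ht h hh, map_mul, map_pow] at hu
  exact (mul_cancel_right_mem_nonZeroDivisors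
    (pow_mem (algebraMap_t_mem_nonZeroDivisors F t ht L g) Dg)).mp hu

include ht in
/-- **Degree-`(0,0)` elements of `(⊕ₙ Jₙ tⁿ)[1/h]`, `h = β t^D`**: if `hⁿ s = y` with
`y = x₀ t^{Dn}` (`x₀ ∈ J_{Dn} ∩ A₀`, i.e. `y` of degree `n · deg h`), then
`s hⁿ (t⁻¹)^{Dn} = x₀`. [folklore] -/
theorem exists_of_pow_mul_eq [Zero ι] {n : ℕ} {y : F.extendedRees}
    (hy : (y : A[T;T⁻¹]) ∈ laurentPiece 𝒜₀ ((0 : ι), ((Dg * n : ℕ) : ℤ))) {s : L}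
    (hs : algebraMap F.extendedRees L h ^ n * s = algebraMap F.extendedRees L y) :
    ∃ x₀ : A, x₀ ∈ F.ideal (Dg * n) ∧ x₀ ∈ 𝒜₀ 0 ∧
      s * algebraMap F.extendedRees L h ^ n * algebraMap F.extendedRees L t ^ (Dg * n) =
        algebraMap F.extendedRees L (algebraMap A F.extendedRees x₀) := by
  obtain ⟨x₀, hx₀, hJ, hyx⟩ := exists_of_coe_mem_laurentPiece hy
  refine ⟨x₀, hJ, hx₀, ?_⟩
  rw [mul_comm s, hs, ← map_pow, ← map_mul, mul_t_pow_eq_algebraMap F t ht y hyx]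

include ht in
/-- … and conversely `x₀ t^{Dl} / hˡ` is such an element: for `y = x₀ t^{Dl}` the element
`s = y · (h⁻¹)ˡ` satisfies `hˡ s = y` and `s hˡ (t⁻¹)^{Dl} = x₀`. [folklore] -/
theorem exists_pow_mul_eq [IsLocalization.Away h L] {l : ℕ} {x₀ : A} (y : F.extendedRees)
    (hy : (y : A[T;T⁻¹]) = C x₀ * T ((Dg * l : ℕ) : ℤ)) :
    ∃ s : L, algebraMap F.extendedRees L h ^ l * s = algebraMap F.extendedRees L y ∧
      s * algebraMap F.extendedRees L h ^ l * algebraMap F.extendedRees L t ^ (Dg * l) =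
        algebraMap F.extendedRees L (algebraMap A F.extendedRees x₀) := by
  obtain ⟨w, hw⟩ : ∃ w : L, algebraMap F.extendedRees L h * w = 1 :=
    ⟨IsLocalization.Away.invSelf h, IsLocalization.Away.mul_invSelf h⟩
  have hw' : algebraMap F.extendedRees L h ^ l * w ^ l = 1 := by rw [← mul_pow, hw, one_pow]
  refine ⟨algebraMap F.extendedRees L y * w ^ l, ?_, ?_⟩
  · rw [mul_left_comm, hw', mul_one]
  · rw [mul_assoc (algebraMap _ L y), mul_comm (w ^ l), hw', mul_one, ← map_pow, ← map_mul,
      mul_t_pow_eq_algebraMap F t ht y hy]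

end Local

/-! ## Registered form -/

/-- **Registered sub-goal `stub_qs_atlasAmbientRees`** of the crux (helper of the stub
`stub_qs_atlas_ambient`): `A[t, t⁻¹]` is bigraded and the extended Rees algebra of a filtration
by homogeneous ideals contains the homogeneous components of its elements.
[cite: Wlodarczyk2022, §2.3.3] -/
theorem stub_qs_atlasAmbientRees :
    ∀ {ι A : Type} [AddCommMonoid ι] [DecidableEq ι] [CommRing A] (𝒜₀ : ι → Submodule ℤ A)
      [GradedRing 𝒜₀] (F : Literature.AlgebraicGeometry.Resolution.IdealFiltration A),
      (∀ n, (F.ideal n).IsHomogeneous 𝒜₀) →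
      ∃ _ : GradedRing
        (Summit.ResolutionOfSingularities.ResolutionOfSingularities.Theorems.DatumToEmbedded.AtlasAmbient.laurentPiece 𝒜₀),
        ∀ x ∈ F.extendedRees, ∀ k,
          (DirectSum.decompose
            (Summit.ResolutionOfSingularities.ResolutionOfSingularities.Theorems.DatumToEmbedded.AtlasAmbient.laurentPiece 𝒜₀)
              x k : LaurentPolynomial A) ∈ F.extendedRees := by
  intro ι A _ _ _ 𝒜₀ _ F hF
  obtain ⟨inst⟩ := nonempty_gradedRing_laurentPiece 𝒜₀
  exact ⟨inst, fun x hx k => decompose_mem_extendedRees 𝒜₀ F hF hx k⟩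

end Summit.ResolutionOfSingularities.ResolutionOfSingularities.Theorems.DatumToEmbedded.AtlasAmbient

end
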